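import Summits.AtomisticToContinuum.FouriersLaw.Theses.CageBudgetFekete
import Summits.AtomisticToContinuum.FouriersLaw.Theses.HoelderEscapeProfile
import Summits.AtomisticToContinuum.FouriersLaw.Theorems.HoelderEscapeProfileFibreCalculus
import HarnessLib

/-!
# `CageBudgetFekete.UnboundedHeatVariance`, line Sketch — no frozen site energy ⟹ infrared non-freezing

Support file (`--supports stmt-AtomisticToContinuum-15771`) for the stub
`stub_infraredNonFreezingOfNoFrozenSiteEnergy` of line `Sketch`.

In the arena of the crux let `S(x,t) = Cov(h₀, h_x ∘ φ_t)` be the energy kernel, `S̄_ν(x) = ν ∫₀^∞ e^{-νt} S(x,t) dt`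
its Abel profile, `f̂_ν(k) = Σ_x cos(kx) S̄_ν(x)` and `χ(k) = Σ_x cos(kx) S(x,0)`. The LANDED fibre calculus
(`FibreCalculusSketch.fibreCalculus_proof`) supplies: `(1+x²)`-summability of `S̄_ν` and `S(·,0)` (hence continuity
of `f̂_ν` and `χ` in `k`), `χ(0) > 0`, conservation `Σ_x S̄_ν(x) = χ(0)` (so `f̂_ν(0) = χ(0)`), Bochner `f̂_ν ≥ 0` and
Parseval `∫_{-π}^{π} f̂_ν = 2π S̄_ν(0)`.

**Wavenumber pigeonhole.** If the on-site Abel return `S̄_ν(0) → 0` as `ν ↓ 0`, then for every `M` and `ν₁ > 0`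
there are a wavenumber `k` with `cos k ≠ 1` and a `0 < ν < ν₁` with `M (2 - 2 cos k) ≤ χ(k) - f̂_ν(k)`:
choose `K > 0` so small that `χ ≥ 3χ(0)/4` on `[0,K]` and `(max M 0 + 1) K² ≤ χ(0)/4`, then `ν < ν₁` with
`2π S̄_ν(0) < K χ(0)/2`; the nonnegative continuous `f̂_ν` with `f̂_ν(0) = χ(0)` and total mass `< K χ(0)/2` on
`[-π,π] ⊇ [0,K]` must drop to `≤ χ(0)/2` at some `0 < k ≤ K`, where then
`χ(k) - f̂_ν(k) ≥ χ(0)/4 ≥ (max M 0 + 1)(2 - 2cos k)`.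
The pigeonhole is adapted from the `corner`/`hlow` block of `HoelderEscapeProfile.closes`.
-/

noncomputable section

namespace Summit.AtomisticToContinuum.FouriersLaw.Theorems.UnboundedHeatVariance.Sketch

open MeasureTheory Set Filter Topology
open Literature.MathematicalPhysics.KineticTheory.HeatConduction

/-- A cosine series `k ↦ Σ_x cos(kx) c(x)` with `Σ_x (1+x²)|c(x)| < ∞` is continuous (dominated by `|c x|`).
-- adapted from `cosSeries` in `HoelderEscapeProfile.closes`. [folklore] -/
theorem cosSeries_continuous (c : ℤ → ℝ) (hc : Summable (fun x : ℤ => (1 + (x : ℝ) ^ 2) * |c x|)) :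
    Continuous (fun k : ℝ => ∑' x : ℤ, Real.cos (k * (x : ℝ)) * c x) := by
  refine continuous_tsum (fun x => (Real.continuous_cos.comp (continuous_id.mul continuous_const)).mul
    continuous_const) (Summable.of_nonneg_of_le (fun x => abs_nonneg _)
      (fun x => le_mul_of_one_le_left (abs_nonneg _) (by nlinarith [sq_nonneg (x : ℝ)])) hc) (fun x k => ?_)
  rw [Real.norm_eq_abs, abs_mul]
  exact mul_le_of_le_one_left (abs_nonneg _) (Real.abs_cos_le_one _)

/-- **Wavenumber pigeonhole** (abstract form). Let `χk` be continuous at `0` with `χk 0 > 0`, and for every `ν > 0`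
let `fh ν` be a continuous nonnegative function with `fh ν 0 = χk 0` and `∫_{-π}^{π} fh ν = 2π Ψ ν`. If `Ψ ν → 0`
as `ν ↓ 0`, then for every `M` and `ν₁ > 0` there are `k` with `cos k ≠ 1` and `0 < ν < ν₁` with
`M (2 - 2 cos k) ≤ χk k - fh ν k`. -- adapted from the `hlow` block of `HoelderEscapeProfile.closes`. [folklore] -/
theorem wavenumber_pigeonhole (χk : ℝ → ℝ) (fh : ℝ → ℝ → ℝ) (Ψ : ℝ → ℝ)
    (hχ : 0 < χk 0) (hχc : ContinuousAt χk 0) (hfc : ∀ ν, 0 < ν → Continuous (fh ν))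
    (hf0 : ∀ ν, 0 < ν → fh ν 0 = χk 0) (hfn : ∀ ν, 0 < ν → ∀ k, 0 ≤ fh ν k)
    (hfi : ∀ ν, 0 < ν → ∫ k in (-Real.pi)..Real.pi, fh ν k = 2 * Real.pi * Ψ ν)
    (hΨ : Tendsto Ψ (𝓝[>] 0) (𝓝 0)) (M ν₁ : ℝ) (hν₁ : 0 < ν₁) :
    ∃ k : ℝ, Real.cos k ≠ 1 ∧ ∃ ν : ℝ, 0 < ν ∧ ν < ν₁ ∧ M * (2 - 2 * Real.cos k) ≤ χk k - fh ν k := by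
  set χ := χk 0 with hχdef
  set M' := max M 0 with hM'
  have hM'0 : 0 ≤ M' := le_max_right _ _
  obtain ⟨δ, hδ, hδχ⟩ : ∃ δ > 0, ∀ k, |k| < δ → |χk k - χ| < χ / 4 := by
    obtain ⟨δ, hδ, h⟩ := Metric.continuousAt_iff.mp hχc (χ / 4) (by positivity)
    exact ⟨δ, hδ, fun k hk => by simpa [Real.dist_eq] using h (by simpa [Real.dist_eq] using hk)⟩
  set K := min (min (δ / 2) Real.pi) (Real.sqrt (χ / (4 * (M' + 1)))) with hK
  have hKp : 0 < K := lt_min (lt_min (by positivity) Real.pi_pos) (Real.sqrt_pos.mpr (by positivity))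
  have hKδ : K < δ := lt_of_le_of_lt ((min_le_left _ _).trans (min_le_left _ _)) (by linarith)
  have hKπ : K ≤ Real.pi := (min_le_left _ _).trans (min_le_right _ _)
  have hKs : K ^ 2 ≤ χ / (4 * (M' + 1)) := by
    have e := pow_le_pow_left₀ hKp.le (min_le_right _ _ : K ≤ Real.sqrt (χ / (4 * (M' + 1)))) 2
    rwa [Real.sq_sqrt (by positivity)] at e
  -- choose `ν ∈ (0, ν₁)` with small on-site Abel return
  have hpos : ∀ᶠ ν in 𝓝[>] (0:ℝ), 0 < ν := eventually_mem_nhdsWithin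
  have hsm : ∀ᶠ ν in 𝓝[>] (0:ℝ), ν < ν₁ := nhdsWithin_le_nhds (Iio_mem_nhds hν₁)
  have hΨev : ∀ᶠ ν in 𝓝[>] (0:ℝ), Ψ ν < K * χ / (4 * Real.pi) :=
    hΨ.eventually (gt_mem_nhds (by positivity))
  obtain ⟨ν, hν, hνν₁, hΨν⟩ := (hpos.and (hsm.and hΨev)).exists
  -- pigeonhole in `k`
  obtain ⟨k, ⟨hk0, hkK⟩, hfk⟩ : ∃ k ∈ Ioc (0:ℝ) K, fh ν k ≤ χ / 2 := by
    by_contra H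
    push Not at H
    have hge : ∀ k ∈ Icc (0:ℝ) K, χ / 2 ≤ fh ν k := fun k hk => by
      rcases eq_or_lt_of_le hk.1 with h | h
      · rw [← h, hf0 ν hν]; linarith
      · exact (H k ⟨h, hk.2⟩).le
    have h1 : ∫ k in (0:ℝ)..K, (χ / 2 : ℝ) ≤ ∫ k in (0:ℝ)..K, fh ν k :=
      intervalIntegral.integral_mono_on hKp.le (by simp) ((hfc ν hν).intervalIntegrable _ _) hge
    rw [intervalIntegral.integral_const, smul_eq_mul, sub_zero] at h1
    have h2 : ∫ k in (0:ℝ)..K, fh ν k ≤ ∫ k in (-Real.pi)..Real.pi, fh ν k :=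
      intervalIntegral.integral_mono_interval (neg_nonpos.mpr Real.pi_pos.le) hKp.le hKπ
        (Eventually.of_forall fun k => hfn ν hν k) ((hfc ν hν).intervalIntegrable _ _)
    rw [hfi ν hν] at h2
    have h3 : 2 * Real.pi * Ψ ν < K * χ / 2 :=
      calc 2 * Real.pi * Ψ ν < 2 * Real.pi * (K * χ / (4 * Real.pi)) :=
            mul_lt_mul_of_pos_left hΨν (by positivity)
        _ = K * χ / 2 := by field_simp; ring
    linarith
  have hc1 : Real.cos k < 1 := by
    have e := Real.cos_lt_cos_of_nonneg_of_le_pi le_rfl (hkK.trans hKπ) hk0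
    rwa [Real.cos_zero] at e
  set d := 2 - 2 * Real.cos k with hd
  have hdp : 0 < d := by rw [hd]; linarith
  have hdk : d ≤ K ^ 2 := by
    have e1 := Real.one_sub_sq_div_two_le_cos (x := k)
    have e2 : k ^ 2 ≤ K ^ 2 := pow_le_pow_left₀ hk0.le hkK 2
    rw [hd]; linarith
  have hχk : 3 * χ / 4 ≤ χk k := by
    have e := hδχ k (by rw [abs_of_pos hk0]; exact lt_of_le_of_lt hkK hKδ)
    rw [abs_lt] at e; linarith [e.1]
  refine ⟨k, hc1.ne, ν, hν, hνν₁, ?_⟩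
  have e1 : M * d ≤ M' * d := mul_le_mul_of_nonneg_right (le_max_left _ _) hdp.le
  have e2 : (M' + 1) * d ≤ χ / 4 :=
    calc (M' + 1) * d ≤ (M' + 1) * (χ / (4 * (M' + 1))) :=
          mul_le_mul_of_nonneg_left (hdk.trans hKs) (by positivity)
      _ = χ / 4 := by field_simp
  have e3 : M' * d ≤ (M' + 1) * d := by nlinarith
  linarith

/-- **Stub `stub_infraredNonFreezingOfNoFrozenSiteEnergy`** (edge NoFrozenSiteEnergy ⟹ IR of line `Sketch` of
`CageBudgetFekete.UnboundedHeatVariance`). In the arena of the crux, with the energy kernel `S`, its Abel profile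
`Sb`, the Abel structure factor `fh ν k = Σ_x cos(kx) Sb ν x` and the static one `χk k = Σ_x cos(kx) S x 0`:
if the on-site Abel return `Sb ν 0 → 0` as `ν ↓ 0`, then for every `M` and every `ν₁ > 0` some wavenumber `k`
with `cos k ≠ 1` and some `0 < ν < ν₁` have Abel deficit `χk k - fh ν k ≥ M (2 - 2 cos k)` — the wavenumber
pigeonhole over the landed fibre calculus (`FibreCalculusSketch.fibreCalculus_proof`, clauses 4–9). -/
theorem stub_infraredNonFreezingOfNoFrozenSiteEnergy :
    ∀ ω₂ lam β γ : ℝ, 0 < ω₂ → 0 < lam → 0 < β → ∀ T : ℝ, 0 < T → ∀ μ : MeasureTheory.Measure Literature.MathematicalPhysics.KineticTheory.HeatConduction.ChainConfig, (Literature.MathematicalPhysics.KineticTheory.HeatConduction.pinnedChain ω₂ lam β γ).IsChainGibbsMeasure T μ → Literature.MathematicalPhysics.KineticTheory.HeatConduction.IsShiftInvariant μ → μ.map (fun σ : Literature.MathematicalPhysics.KineticTheory.HeatConduction.ChainConfig => fun x : ℤ => ((σ x).1, -(σ x).2)) = μ → ∀ D : Literature.MathematicalPhysics.KineticTheory.HeatConduction.InfiniteChainDynamics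 (Literature.MathematicalPhysics.KineticTheory.HeatConduction.pinnedChain ω₂ lam β γ), D.PreservesMeasure μ → (∀ t : ℝ, ∀ᵐ σ ∂μ, D.flow t (Literature.MathematicalPhysics.KineticTheory.HeatConduction.shift σ) = Literature.MathematicalPhysics.KineticTheory.HeatConduction.shift (D.flow t σ)) → (∀ t : ℝ, D.HasAbsConvergentCorrelation μ t) → Continuous (fun t : ℝ => D.currentCorrelation μ t) → ∀ h : Literature.MathematicalPhysics.KineticTheory.HeatConduction.ChainConfig → ℤ → ℝ, h = (fun (σ : Literature.MathematicalPhysics.KineticTheory.HeatConduction.ChainConfig) (x : ℤ) => (σ x).2 ^ 2 / 2 + (Literature.MathematicalPhysics.KineticTheory.HeatConduction.pinnedChain ω₂ lam β γ).U (σ x).1 + ((Literature.MathematicalPhysics.KineticTheory.HeatConduction.pinnedChain ω₂ lam β γ).V ((σ (x + 1)).1 - (σ x).1) + (Literature.MathematicalPhysics.KineticTheory.HeatConduction.pinnedChain ω₂ lam β γ).V ((σ x).1 - (σ (x - 1)).1)) / 2) → ∀ S : ℤ → ℝ → ℝ, S = (fun (x : ℤ) (t : ℝ) => ∫ σ, (h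 σ 0 - ∫ σ', h σ' 0 ∂μ) * (h (D.flow t σ) x - ∫ σ', h σ' 0 ∂μ) ∂μ) → ∀ Sb : ℝ → ℤ → ℝ, Sb = (fun (ν : ℝ) (x : ℤ) => ν * ∫ t in Set.Ioi (0:ℝ), Real.exp (-(ν * t)) * S x t) → ∀ fh : ℝ → ℝ → ℝ, fh = (fun (ν k : ℝ) => ∑' x : ℤ, Real.cos (k * (x : ℝ)) * Sb ν x) → ∀ χk : ℝ → ℝ, χk = (fun k : ℝ => ∑' x : ℤ, Real.cos (k * (x : ℝ)) * S x 0) → Filter.Tendsto (fun ν : ℝ => Sb ν 0) (nhdsWithin (0:ℝ) (Set.Ioi 0)) (nhds 0) → ∀ M ν₁ : ℝ, 0 < ν₁ → ∃ k : ℝ, Real.cos k ≠ 1 ∧ ∃ ν : ℝ, 0 < ν ∧ ν < ν₁ ∧ M * (2 - 2 * Real.cos k) ≤ χk k - fh ν k := by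
  intro ω₂ lam β γ hω hl hβ T hT μ hG hSI hRefl D hP hShift _ _ h hh S hS Sb hSb fh hfh χk hχk hΨ M ν₁ hν₁
  obtain ⟨_, _, _, h4, h5, h6, h7, h8, h9, _, _, _⟩ :=
    Summit.AtomisticToContinuum.FouriersLaw.Theorems.FibreCalculusSketch.fibreCalculus_proof ω₂ lam β γ hω hl hβ T
      hT μ hG hSI hRefl D hP hShift h hh S hS Sb hSb _ rfl _ rfl fh hfh χk hχk
  exact wavenumber_pigeonhole χk fh (fun ν => Sb ν 0) h6
    (by rw [hχk]; exact (cosSeries_continuous _ h5).continuousAt)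
    (fun ν hν => by rw [hfh]; exact cosSeries_continuous _ (h4 ν hν))
    (fun ν hν => by simp only [hfh, zero_mul, Real.cos_zero, one_mul]; exact h7 ν hν)
    h8 h9 hΨ M ν₁ hν₁

end Summit.AtomisticToContinuum.FouriersLaw.Theorems.UnboundedHeatVariance.Sketch

end
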